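import Literature.AlgebraicGeometry.ModuliOfAbelianVarieties.SiegelFamilyRealCohomologyDoubleCosets
import HarnessLib

/-!
# Goresky–Tai 2003 §8.2 (the «moreover» part of Proposition 23) at matrix level: for `v = (A B; 0 ᵗA⁻¹) ∈ Γ_g(2)`
# with `ṽv ∈ Γ_g(2N)` the congruences (8.3), the unipotent `x = (I −½A⁻¹B; 0 I)` with `x̃⁻¹vx = (A B′; 0 ᵗA⁻¹)`,
# `B′ ≡ 0 (mod N)`, the splitting `u′ = u·u₂`, `u₂ ∈ Γ_g(N)`, and `γ′ = τ(g)ug⁻¹ ∈ Γ_g(N)`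

Topic `Literature/AlgebraicGeometry/ModuliOfAbelianVarieties` (the Siegel-family files, namespace
`Literature.AlgebraicGeometry.ModuliOfAbelianVarieties.SiegelModuli`).  Lane `lit-hodgefound` (Track 2 foundations
library), prover seat p15 generation 54, row g54-#4; companion of g54-#3 `SiegelFamilyRealBlockDiagonalNormalForm`
(§8.3, §10.2–10.3) in the vocabulary of g52-#5 `SiegelFamilyRealCohomologyDoubleCosets` (`τ(x) = KxK`,
`K = (−1 0; 0 1)`, as `⟨K·x·K, iStar_mul_mul_iStar_mem_symplecticGroup _⟩`; `(P 0; 0 Q) ∈ Sp ⟺ ᵗPQ = 1`;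
`Γ_g(N) = siegelPrincipalGamma g N`).  THEOREMS ONLY: no definition, no instance, no notation, no named fact (net
Literature debt `0`), no `sorry`.  What is NOT here: boundary components, `P_q`, `𝒰(P_q)`, `ker ν` (no Baily–Borel
compactification in the tree) — the statements below are the matrix computations the printed proof performs, so that
Proposition 23 reduces to them once boundary components are available.

## Source, VERBATIM

M. Goresky, Y. S. Tai, *The moduli space of real abelian varieties with level structure*, Compositio Math. **139**
(2003) = arXiv:math/0108103, held `paper:arxiv-math_0108103`, §8.2 (p0015), proof of the «moreover» part of
Proposition 23 («Moreover, we may take `B = 0`, that is, there exists `γ′ ∈ Γ(4m)` and `g ∈ Sp(2n, ℤ)` so that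
`F^{γ′} = F^γ`, `g(F_q) = F`, and so that `g̃⁻¹γ′g = (A 0; 0 ᵗA⁻¹) ∈ ker(ν)`»): «By Lemma 9, both `γ̃γ⁻¹` and `γ̃γ` are
in `Γ(8m)`.  Then `γ̃γ = ãṽvã⁻¹ ∈ Γ(8m)`, hence `ṽv ∈ Γ(8m)`.  Calculating `ṽv ≡ I mod 8m` gives
(8.3) `AB ≡ BᵗA⁻¹ mod 8m` and `A² ≡ I mod 8m`.  Since `v = ã⁻¹aa⁻¹γa ∈ Γ(2)` the matrix `A` is integral and `B` is
even, so `x = (I −½A⁻¹B; 0 I)` is integral. […] Set `g = ax` and set `u′ = x̃⁻¹vx`.  Direct computation with the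
matrices for `x` and `v` gives `u′ = (A B′; 0 ᵗA⁻¹)` where `B′ = ½B − ½A⁻¹BᵗA⁻¹`.  Using (8.3) gives `B′ ≡ 0 mod 4m`.
[…] Now decompose `u′ = uu₂` where `u = (A 0; 0 ᵗA⁻¹)` and `u₂ = (I A⁻¹B′; 0 I) ∈ ker(ν)`.  Set `γ′ = g̃ug⁻¹`. […]
First note that `u₂ ∈ Γ(4m)` since `B′ ≡ 0 mod 4m`.  Then `γ′ ∈ Γ(4m)` because
`γ = ãva⁻¹ = g̃u′g⁻¹ = (g̃ug⁻¹)(gu₂g⁻¹) = γ′(gu₂g⁻¹) ∈ Γ(4m)`.»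

## Rendering

`v = (A B; 0 D) ∈ Sp_{2g}(ℤ)` forces `ᵗAD = 1` (`D = ᵗA⁻¹`, `A⁻¹ = ᵗD`) and `ᵗBD = ᵗDB`; the level `8m = 2·4m` is
generalised to `2N` for any `N` (conclusions modulo `N`); `½A⁻¹B` is `ᵗD B₀` with `2B₀ = B`.  `x̃ = KxK = (I −X; 0 I)`
is `x⁻¹`, so `x̃⁻¹vx = xvx`.

## What is proved

* §1 `iStar_mul_fromBlocks_zero_mul_iStar_mul_self` (`ṽv = (A² AB − BD; 0 D²)`),
  **`map_eq_of_iStarConj_mul_self_mem_siegelPrincipalGamma`** ((8.3): `ṽv ∈ Γ_g(M)` ⟹ `A² ≡ I`, `AB ≡ BD`, `D² ≡ I`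
  (mod `M`)).
* §2 ★ **`exists_unipotent_conj_eq_blockDiagonal_mul_of_mem_siegelPrincipalGamma`** (the «moreover» computation:
  `X = −½A⁻¹B` symmetric, `x = (I X; 0 I) ∈ Sp_{2g}(ℤ)` with `τ(x) = x⁻¹`, `xvx = (A B′; 0 D)` with
  `2B′ = B − ᵗDBD`, `B′ ≡ 0 (mod N)`, `(A B′; 0 D) = (A 0; 0 D)·(I ᵗDB′; 0 I)` with both factors in `Sp_{2g}(ℤ)` and the
  unipotent one in `Γ_g(N)`).
* §3 **`eq_iStarConj_mul_mul_inv_mul_and_mem_siegelPrincipalGamma`** (`γ = γ′·(gu₂g⁻¹)` and `γ′ ∈ Γ_g(N)`).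

## References

* [GoreskyTai2003RealModuli] M. Goresky, Y. S. Tai, Compositio Math. 139 (2003) 1–27 (arXiv:math/0108103), §8.2
  (proof of Proposition 23), (8.3).
-/

noncomputable section

open scoped Matrix
open Matrix Function

namespace Literature.AlgebraicGeometry.ModuliOfAbelianVarieties

namespace SiegelModuli

open Literature.NumberTheory.ModularForms.SiegelModularForm (siegelPrincipalGamma mem_siegelPrincipalGamma_iff
  normal_siegelPrincipalGamma)

variable {g : ℕ}

/-! ## §1 Block upper-triangular symplectic matrices `v = (A B; 0 D)` and `τ(v)v` -/

section Triangular

/-- `(A B; 0 D) ∈ Sp_{2g}(R)` iff `ᵗAD = 1` and `ᵗBD = ᵗDB` (Mathlib's block criterion with `C = 0`).  [folklore] -/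
private theorem fromBlocks_zero₂₁_mem_symplecticGroup_iff {R : Type*} [CommRing R] (A B D : Matrix (Fin g) (Fin g) R) :
    fromBlocks A B 0 D ∈ Matrix.symplecticGroup (Fin g) R ↔ Aᵀ * D = 1 ∧ Bᵀ * D = Dᵀ * B := by
  rw [SymplecticGroup.fromBlocks_mem_iff]
  simp only [transpose_zero, Matrix.mul_zero, Matrix.zero_mul, sub_zero, true_and]
  exact ⟨fun h => ⟨h.2, h.1⟩, fun h => ⟨h.2, h.1⟩⟩

/-- **`τ(v)v` for `v = (A B; 0 D)`**: `(KvK)·v = (A² AB − BD; 0 D²)` («Calculating `ṽv`»).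
[cite: GoreskyTai2003RealModuli, §8.2 (proof of Proposition 23, «Calculating `ṽv ≡ I mod 8m` gives (8.3)»)] -/
theorem iStar_mul_fromBlocks_zero_mul_iStar_mul_self {R : Type*} [CommRing R] (A B D : Matrix (Fin g) (Fin g) R) :
    fromBlocks (-1 : Matrix (Fin g) (Fin g) R) 0 0 (1 : Matrix (Fin g) (Fin g) R) * fromBlocks A B 0 D *
        fromBlocks (-1 : Matrix (Fin g) (Fin g) R) 0 0 (1 : Matrix (Fin g) (Fin g) R) * fromBlocks A B 0 D =
      fromBlocks (A * A) (A * B - B * D) 0 (D * D) := by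
  rw [iStar_mul_fromBlocks_mul_iStar, fromBlocks_multiply]
  simp [sub_eq_add_neg]

/-- **(8.3)**: if `τ(v)v ∈ Γ_g(M)` for `v = (A B; 0 D) ∈ Sp_{2g}(ℤ)` then `A² ≡ I`, `AB ≡ BD` (`= BᵗA⁻¹`) and `D² ≡ I`
modulo `M` («Calculating `ṽv ≡ I mod 8m` gives `AB ≡ BᵗA⁻¹ mod 8m` and `A² ≡ I mod 8m`»).
[cite: GoreskyTai2003RealModuli, §8.2 (8.3)] -/
theorem map_eq_of_iStarConj_mul_self_mem_siegelPrincipalGamma {M : ℕ} {A B D : Matrix (Fin g) (Fin g) ℤ}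
    (hv : fromBlocks A B 0 D ∈ Matrix.symplecticGroup (Fin g) ℤ)
    (hM : (⟨fromBlocks (-1 : Matrix (Fin g) (Fin g) ℤ) 0 0 (1 : Matrix (Fin g) (Fin g) ℤ) * fromBlocks A B 0 D *
          fromBlocks (-1 : Matrix (Fin g) (Fin g) ℤ) 0 0 (1 : Matrix (Fin g) (Fin g) ℤ), iStar_mul_mul_iStar_mem_symplecticGroup hv⟩ *
        ⟨fromBlocks A B 0 D, hv⟩ : Matrix.symplecticGroup (Fin g) ℤ) ∈ siegelPrincipalGamma g M) :
    (A * A).map (Int.castRingHom (ZMod M)) = 1 ∧ (A * B).map (Int.castRingHom (ZMod M)) = (B * D).map (Int.castRingHom (ZMod M)) ∧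
      (D * D).map (Int.castRingHom (ZMod M)) = 1 := by
  have h := mem_siegelPrincipalGamma_iff.1 hM
  rw [Submonoid.coe_mul] at h
  change (fromBlocks (-1 : Matrix (Fin g) (Fin g) ℤ) 0 0 (1 : Matrix (Fin g) (Fin g) ℤ) * fromBlocks A B 0 D *
      fromBlocks (-1 : Matrix (Fin g) (Fin g) ℤ) 0 0 (1 : Matrix (Fin g) (Fin g) ℤ) * fromBlocks A B 0 D).map _ = 1 at h
  rw [iStar_mul_fromBlocks_zero_mul_iStar_mul_self, fromBlocks_map, ← fromBlocks_one, Matrix.fromBlocks_inj] at h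
  refine ⟨h.1, ?_, h.2.2.2⟩
  rw [← sub_eq_zero, ← Matrix.map_sub _ (map_sub (Int.castRingHom (ZMod M))), h.2.1]

end Triangular

/-! ## §2 The reduction `x̃⁻¹vx = (A B′; 0 ᵗA⁻¹)`, `B′ ≡ 0 (mod N)`, `u′ = u·u₂` (the «moreover» part of Prop. 23) -/

section Reduction

/-- An integer matrix which vanishes modulo `2` is twice an integer matrix.  [folklore] -/
private theorem exists_two_smul_eq_of_map_eq_zero {B : Matrix (Fin g) (Fin g) ℤ} (h : B.map (Int.castRingHom (ZMod 2)) = 0) :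
    ∃ B₀ : Matrix (Fin g) (Fin g) ℤ, (2 : ℤ) • B₀ = B := by
  refine ⟨Matrix.of fun i j => B i j / 2, ?_⟩
  ext i j
  have hij := congrFun (congrFun h i) j
  simp only [map_apply, eq_intCast, Matrix.zero_apply] at hij
  rw [Matrix.smul_apply, of_apply, smul_eq_mul]
  exact Int.mul_ediv_cancel' ((ZMod.intCast_zmod_eq_zero_iff_dvd _ 2).1 hij)

/-- Halving a congruence: `2X ≡ 0 (mod 2N)` entrywise ⟹ `X ≡ 0 (mod N)`.  [folklore] -/
private theorem map_eq_zero_of_two_smul_map_eq_zero {N : ℕ} {X : Matrix (Fin g) (Fin g) ℤ}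
    (h : ((2 : ℤ) • X).map (Int.castRingHom (ZMod (2 * N))) = 0) : X.map (Int.castRingHom (ZMod N)) = 0 := by
  ext i j
  have hij := congrFun (congrFun h i) j
  simp only [map_apply, eq_intCast, Matrix.zero_apply, Matrix.smul_apply, smul_eq_mul] at hij ⊢
  rw [ZMod.intCast_zmod_eq_zero_iff_dvd] at hij ⊢
  rw [Nat.cast_mul, Nat.cast_ofNat] at hij
  exact (mul_dvd_mul_iff_left (by norm_num : (2 : ℤ) ≠ 0)).1 hij

/-- **Goresky–Tai 2003, §8.2 — the «moreover» part of Proposition 23, at matrix level.**  Let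
`v = (A B; 0 D) ∈ Sp_{2g}(ℤ)` (so `D = ᵗA⁻¹`) lie in `Γ_g(2)` («the matrix `A` is integral and `B` is even») with
`τ(v)v ∈ Γ_g(2N)` (GT: `ṽv ∈ Γ(8m)`, `N = 4m`).  Then with `X = −½A⁻¹B` (integral, symmetric) the unipotent
`x = (I X; 0 I) ∈ Sp_{2g}(ℤ)` satisfies `τ(x) = x⁻¹`, and «direct computation with the matrices for `x` and `v` gives
`u′ = x̃⁻¹vx = (A B′; 0 ᵗA⁻¹)` where `B′ = ½B − ½A⁻¹BᵗA⁻¹`.  Using (8.3) gives `B′ ≡ 0 mod 4m`» (here: `mod N`); and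
«decompose `u′ = uu₂` where `u = (A 0; 0 ᵗA⁻¹)` and `u₂ = (I A⁻¹B′; 0 I)`», `u, u₂ ∈ Sp_{2g}(ℤ)`, `u₂ ∈ Γ_g(N)` («since
`B′ ≡ 0 mod 4m`»).  The parabolic bookkeeping (`x ∈ 𝒰(P_q) ⊂ ker ν`) is not asserted (no boundary components in the
tree).  [cite: GoreskyTai2003RealModuli, §8.2 (proof of Proposition 23, «moreover» part)] -/
theorem exists_unipotent_conj_eq_blockDiagonal_mul_of_mem_siegelPrincipalGamma {N : ℕ} {A B D : Matrix (Fin g) (Fin g) ℤ}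
    (hv : fromBlocks A B 0 D ∈ Matrix.symplecticGroup (Fin g) ℤ)
    (h2 : (⟨fromBlocks A B 0 D, hv⟩ : Matrix.symplecticGroup (Fin g) ℤ) ∈ siegelPrincipalGamma g 2)
    (hN : (⟨fromBlocks (-1 : Matrix (Fin g) (Fin g) ℤ) 0 0 (1 : Matrix (Fin g) (Fin g) ℤ) * fromBlocks A B 0 D *
          fromBlocks (-1 : Matrix (Fin g) (Fin g) ℤ) 0 0 (1 : Matrix (Fin g) (Fin g) ℤ), iStar_mul_mul_iStar_mem_symplecticGroup hv⟩ *
        ⟨fromBlocks A B 0 D, hv⟩ : Matrix.symplecticGroup (Fin g) ℤ) ∈ siegelPrincipalGamma g (2 * N)) :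
    ∃ X : Matrix (Fin g) (Fin g) ℤ, Xᵀ = X ∧ (2 : ℤ) • X = -(Dᵀ * B) ∧
      ∃ hx : fromBlocks (1 : Matrix (Fin g) (Fin g) ℤ) X 0 1 ∈ Matrix.symplecticGroup (Fin g) ℤ,
        -- `τ(x) = x⁻¹`
        (⟨fromBlocks (-1 : Matrix (Fin g) (Fin g) ℤ) 0 0 (1 : Matrix (Fin g) (Fin g) ℤ) * fromBlocks (1 : Matrix (Fin g) (Fin g) ℤ) X 0 1 *
            fromBlocks (-1 : Matrix (Fin g) (Fin g) ℤ) 0 0 (1 : Matrix (Fin g) (Fin g) ℤ), iStar_mul_mul_iStar_mem_symplecticGroup hx⟩ :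
            Matrix.symplecticGroup (Fin g) ℤ) = ⟨fromBlocks (1 : Matrix (Fin g) (Fin g) ℤ) X 0 1, hx⟩⁻¹ ∧
        ∃ B' : Matrix (Fin g) (Fin g) ℤ, (2 : ℤ) • B' = B - Dᵀ * B * D ∧ B'.map (Int.castRingHom (ZMod N)) = 0 ∧
          -- `x̃⁻¹ v x = x v x = (A B′; 0 D)`
          fromBlocks (1 : Matrix (Fin g) (Fin g) ℤ) X 0 1 * fromBlocks A B 0 D * fromBlocks (1 : Matrix (Fin g) (Fin g) ℤ) X 0 1 =
            fromBlocks A B' 0 D ∧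
          -- `u′ = u u₂`
          fromBlocks A B' 0 D = fromBlocks A 0 0 D * fromBlocks (1 : Matrix (Fin g) (Fin g) ℤ) (Dᵀ * B') 0 1 ∧
          fromBlocks A 0 0 D ∈ Matrix.symplecticGroup (Fin g) ℤ ∧
          ∃ hu₂ : fromBlocks (1 : Matrix (Fin g) (Fin g) ℤ) (Dᵀ * B') 0 1 ∈ Matrix.symplecticGroup (Fin g) ℤ,
            (⟨fromBlocks (1 : Matrix (Fin g) (Fin g) ℤ) (Dᵀ * B') 0 1, hu₂⟩ : Matrix.symplecticGroup (Fin g) ℤ) ∈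
              siegelPrincipalGamma g N := by
  -- the symplectic conditions and `A⁻¹ = ᵗD`
  obtain ⟨hAD, hBD⟩ := (fromBlocks_zero₂₁_mem_symplecticGroup_iff A B D).1 hv
  have hDA : Dᵀ * A = 1 := by rw [← transpose_transpose A, ← transpose_mul, hAD, transpose_one]
  have hAD' : A * Dᵀ = 1 := mul_eq_one_comm.1 hDA
  -- `B` is even
  have hB2 : B.map (Int.castRingHom (ZMod 2)) = 0 := by
    have h := mem_siegelPrincipalGamma_iff.1 h2
    change (fromBlocks A B 0 D).map _ = 1 at h
    rw [fromBlocks_map, ← fromBlocks_one] at h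
    exact (Matrix.fromBlocks_inj.1 h).2.1
  obtain ⟨B₀, hB₀⟩ := exists_two_smul_eq_of_map_eq_zero hB2
  -- (8.3)
  obtain ⟨-, hAB, -⟩ := map_eq_of_iStarConj_mul_self_mem_siegelPrincipalGamma hv hN
  -- `S₀ = ᵗD B₀` is symmetric (`ᵗB D = ᵗD B`, cancel `2`)
  have hS₀ : (Dᵀ * B₀)ᵀ = Dᵀ * B₀ := by
    have h2 : (2 : ℤ) • (Dᵀ * B₀)ᵀ = (2 : ℤ) • (Dᵀ * B₀) := by
      rw [transpose_mul, transpose_transpose, ← smul_mul_assoc, ← transpose_smul, hB₀, ← Matrix.mul_smul, hB₀, hBD]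
    exact smul_right_injective _ (two_ne_zero) h2
  set X : Matrix (Fin g) (Fin g) ℤ := -(Dᵀ * B₀) with hX
  have hXt : Xᵀ = X := by rw [hX, transpose_neg, hS₀]
  have hx : fromBlocks (1 : Matrix (Fin g) (Fin g) ℤ) X 0 1 ∈ Matrix.symplecticGroup (Fin g) ℤ := by
    rw [fromBlocks_zero₂₁_mem_symplecticGroup_iff]
    exact ⟨by rw [transpose_one, Matrix.one_mul], by rw [transpose_one, Matrix.mul_one, Matrix.one_mul, hXt]⟩
  -- `B′ = B₀ − ᵗD B₀ D`
  set B' : Matrix (Fin g) (Fin g) ℤ := B₀ - Dᵀ * B₀ * D with hB'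
  have h2B' : (2 : ℤ) • B' = B - Dᵀ * B * D := by
    rw [hB', smul_sub, hB₀, ← hB₀, Matrix.mul_smul, smul_mul_assoc]
  have hB'N : B'.map (Int.castRingHom (ZMod N)) = 0 := by
    apply map_eq_zero_of_two_smul_map_eq_zero
    rw [h2B', Matrix.map_sub _ (map_sub (Int.castRingHom (ZMod (2 * N)))), sub_eq_zero, Matrix.map_mul, Matrix.map_mul,
      Matrix.mul_assoc, ← Matrix.map_mul, ← hAB, Matrix.map_mul, ← Matrix.mul_assoc, ← Matrix.map_mul, hDA,
      Matrix.map_one _ (map_zero _) (map_one _), Matrix.one_mul]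
  have hconj : fromBlocks (1 : Matrix (Fin g) (Fin g) ℤ) X 0 1 * fromBlocks A B 0 D *
      fromBlocks (1 : Matrix (Fin g) (Fin g) ℤ) X 0 1 = fromBlocks A B' 0 D := by
    rw [fromBlocks_multiply, fromBlocks_multiply]
    simp only [Matrix.one_mul, Matrix.mul_one, Matrix.mul_zero, Matrix.zero_mul, add_zero, zero_add]
    congr 1
    rw [hX, Matrix.mul_neg, ← Matrix.mul_assoc, hAD', Matrix.one_mul, Matrix.neg_mul, hB', ← hB₀, two_smul]
    abel
  have hdec : fromBlocks A B' 0 D = fromBlocks A 0 0 D * fromBlocks (1 : Matrix (Fin g) (Fin g) ℤ) (Dᵀ * B') 0 1 := by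
    rw [fromBlocks_multiply]
    simp only [Matrix.one_mul, Matrix.mul_one, Matrix.mul_zero, Matrix.zero_mul, add_zero, zero_add, ← Matrix.mul_assoc, hAD',
      Matrix.one_mul]
  have hu : fromBlocks A 0 0 D ∈ Matrix.symplecticGroup (Fin g) ℤ := (fromBlocks_zero_zero_mem_symplecticGroup_iff A D).2 hAD
  have hS' : (Dᵀ * B')ᵀ = Dᵀ * B' := by
    have h1 : Dᵀ * B' = Dᵀ * B₀ - Dᵀ * (Dᵀ * B₀) * D := by
      rw [hB', Matrix.mul_sub, Matrix.mul_assoc, Matrix.mul_assoc, Matrix.mul_assoc]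
    rw [h1, transpose_sub, transpose_mul (Dᵀ * (Dᵀ * B₀)) D, transpose_mul Dᵀ (Dᵀ * B₀), transpose_transpose, hS₀]
    simp only [Matrix.mul_assoc]
  have hu₂ : fromBlocks (1 : Matrix (Fin g) (Fin g) ℤ) (Dᵀ * B') 0 1 ∈ Matrix.symplecticGroup (Fin g) ℤ := by
    rw [fromBlocks_zero₂₁_mem_symplecticGroup_iff]
    exact ⟨by rw [transpose_one, Matrix.one_mul], by rw [transpose_one, Matrix.mul_one, Matrix.one_mul, hS']⟩
  have hu₂N : (⟨fromBlocks (1 : Matrix (Fin g) (Fin g) ℤ) (Dᵀ * B') 0 1, hu₂⟩ : Matrix.symplecticGroup (Fin g) ℤ) ∈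
      siegelPrincipalGamma g N := by
    rw [mem_siegelPrincipalGamma_iff]
    change (fromBlocks (1 : Matrix (Fin g) (Fin g) ℤ) (Dᵀ * B') 0 1).map _ = 1
    rw [fromBlocks_map, Matrix.map_mul, hB'N, Matrix.mul_zero, Matrix.map_one _ (map_zero _) (map_one _),
      Matrix.map_zero _ (map_zero _), fromBlocks_one]
  -- `τ(x) = x⁻¹`
  have hτx : (⟨fromBlocks (-1 : Matrix (Fin g) (Fin g) ℤ) 0 0 (1 : Matrix (Fin g) (Fin g) ℤ) * fromBlocks (1 : Matrix (Fin g) (Fin g) ℤ) X 0 1 *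
        fromBlocks (-1 : Matrix (Fin g) (Fin g) ℤ) 0 0 (1 : Matrix (Fin g) (Fin g) ℤ), iStar_mul_mul_iStar_mem_symplecticGroup hx⟩ :
        Matrix.symplecticGroup (Fin g) ℤ) = ⟨fromBlocks (1 : Matrix (Fin g) (Fin g) ℤ) X 0 1, hx⟩⁻¹ := by
    apply eq_inv_of_mul_eq_one_left
    apply Subtype.ext
    change fromBlocks (-1 : Matrix (Fin g) (Fin g) ℤ) 0 0 (1 : Matrix (Fin g) (Fin g) ℤ) * fromBlocks (1 : Matrix (Fin g) (Fin g) ℤ) X 0 1 *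
        fromBlocks (-1 : Matrix (Fin g) (Fin g) ℤ) 0 0 (1 : Matrix (Fin g) (Fin g) ℤ) * fromBlocks (1 : Matrix (Fin g) (Fin g) ℤ) X 0 1 = 1
    rw [iStar_mul_fromBlocks_mul_iStar, fromBlocks_multiply, ← fromBlocks_one]
    simp
  exact ⟨X, hXt, by rw [hX, smul_neg, ← Matrix.mul_smul, hB₀], hx, hτx, B', h2B', hB'N, hconj, hdec, hu, hu₂, hu₂N⟩

end Reduction

/-! ## §3 `γ = γ′·(gu₂g⁻¹)`: the new cocycle `γ′ = τ(g)ug⁻¹` lies in `Γ_g(N)` -/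

section Cocycle

/-- **«`γ′ ∈ Γ(4m)` because `γ = ãva⁻¹ = g̃u′g⁻¹ = (g̃ug⁻¹)(gu₂g⁻¹) = γ′(gu₂g⁻¹) ∈ Γ(4m)`»** — the group algebra of
§8.2: if `γ ∈ Γ_g(N)`, `x̃⁻¹(ã⁻¹γa)x = uu₂` and `u₂ ∈ Γ_g(N)` then, with `g = ax` and `γ′ = τ(g)ug⁻¹`,
`γ = γ′·(gu₂g⁻¹)` and `γ′ ∈ Γ_g(N)` (`Γ_g(N)` normal).  Here `τ(y) = KyK`.
[cite: GoreskyTai2003RealModuli, §8.2 (proof of Proposition 23, «moreover» part)] -/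
theorem eq_iStarConj_mul_mul_inv_mul_and_mem_siegelPrincipalGamma (N : ℕ) (γ a x u u₂ : Matrix.symplecticGroup (Fin g) ℤ)
    (hγ : γ ∈ siegelPrincipalGamma g N) (hu₂ : u₂ ∈ siegelPrincipalGamma g N)
    (hrel : (⟨fromBlocks (-1 : Matrix (Fin g) (Fin g) ℤ) 0 0 (1 : Matrix (Fin g) (Fin g) ℤ) * (x : Matrix (Fin g ⊕ Fin g) (Fin g ⊕ Fin g) ℤ) *
          fromBlocks (-1 : Matrix (Fin g) (Fin g) ℤ) 0 0 (1 : Matrix (Fin g) (Fin g) ℤ), iStar_mul_mul_iStar_mem_symplecticGroup x.2⟩ :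
          Matrix.symplecticGroup (Fin g) ℤ)⁻¹ *
        ((⟨fromBlocks (-1 : Matrix (Fin g) (Fin g) ℤ) 0 0 (1 : Matrix (Fin g) (Fin g) ℤ) * (a : Matrix (Fin g ⊕ Fin g) (Fin g ⊕ Fin g) ℤ) *
            fromBlocks (-1 : Matrix (Fin g) (Fin g) ℤ) 0 0 (1 : Matrix (Fin g) (Fin g) ℤ), iStar_mul_mul_iStar_mem_symplecticGroup a.2⟩ :
            Matrix.symplecticGroup (Fin g) ℤ)⁻¹ * γ * a) * x = u * u₂) :
    γ = (⟨fromBlocks (-1 : Matrix (Fin g) (Fin g) ℤ) 0 0 (1 : Matrix (Fin g) (Fin g) ℤ) * ((a * x : Matrix.symplecticGroup (Fin g) ℤ) :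
            Matrix (Fin g ⊕ Fin g) (Fin g ⊕ Fin g) ℤ) * fromBlocks (-1 : Matrix (Fin g) (Fin g) ℤ) 0 0 (1 : Matrix (Fin g) (Fin g) ℤ),
          iStar_mul_mul_iStar_mem_symplecticGroup (a * x).2⟩ : Matrix.symplecticGroup (Fin g) ℤ) * u * (a * x)⁻¹ *
        ((a * x) * u₂ * (a * x)⁻¹) ∧
      (⟨fromBlocks (-1 : Matrix (Fin g) (Fin g) ℤ) 0 0 (1 : Matrix (Fin g) (Fin g) ℤ) * ((a * x : Matrix.symplecticGroup (Fin g) ℤ) :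
            Matrix (Fin g ⊕ Fin g) (Fin g ⊕ Fin g) ℤ) * fromBlocks (-1 : Matrix (Fin g) (Fin g) ℤ) 0 0 (1 : Matrix (Fin g) (Fin g) ℤ),
          iStar_mul_mul_iStar_mem_symplecticGroup (a * x).2⟩ : Matrix.symplecticGroup (Fin g) ℤ) * u * (a * x)⁻¹ ∈
        siegelPrincipalGamma g N := by
  rw [conjK_mk_mul]
  have hγeq : γ = (⟨fromBlocks (-1 : Matrix (Fin g) (Fin g) ℤ) 0 0 (1 : Matrix (Fin g) (Fin g) ℤ) * (a : Matrix (Fin g ⊕ Fin g) (Fin g ⊕ Fin g) ℤ) *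
            fromBlocks (-1 : Matrix (Fin g) (Fin g) ℤ) 0 0 (1 : Matrix (Fin g) (Fin g) ℤ), iStar_mul_mul_iStar_mem_symplecticGroup a.2⟩ :
            Matrix.symplecticGroup (Fin g) ℤ) *
      (⟨fromBlocks (-1 : Matrix (Fin g) (Fin g) ℤ) 0 0 (1 : Matrix (Fin g) (Fin g) ℤ) * (x : Matrix (Fin g ⊕ Fin g) (Fin g ⊕ Fin g) ℤ) *
          fromBlocks (-1 : Matrix (Fin g) (Fin g) ℤ) 0 0 (1 : Matrix (Fin g) (Fin g) ℤ), iStar_mul_mul_iStar_mem_symplecticGroup x.2⟩ :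
          Matrix.symplecticGroup (Fin g) ℤ) * (u * u₂) * x⁻¹ * a⁻¹ := by
    rw [← hrel]
    group
  have hid : γ = (⟨fromBlocks (-1 : Matrix (Fin g) (Fin g) ℤ) 0 0 (1 : Matrix (Fin g) (Fin g) ℤ) * (a : Matrix (Fin g ⊕ Fin g) (Fin g ⊕ Fin g) ℤ) *
            fromBlocks (-1 : Matrix (Fin g) (Fin g) ℤ) 0 0 (1 : Matrix (Fin g) (Fin g) ℤ), iStar_mul_mul_iStar_mem_symplecticGroup a.2⟩ :
            Matrix.symplecticGroup (Fin g) ℤ) *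
      (⟨fromBlocks (-1 : Matrix (Fin g) (Fin g) ℤ) 0 0 (1 : Matrix (Fin g) (Fin g) ℤ) * (x : Matrix (Fin g ⊕ Fin g) (Fin g ⊕ Fin g) ℤ) *
          fromBlocks (-1 : Matrix (Fin g) (Fin g) ℤ) 0 0 (1 : Matrix (Fin g) (Fin g) ℤ), iStar_mul_mul_iStar_mem_symplecticGroup x.2⟩ :
          Matrix.symplecticGroup (Fin g) ℤ) * u * (a * x)⁻¹ * ((a * x) * u₂ * (a * x)⁻¹) := by
    rw [hγeq]
    group
  refine ⟨hid, ?_⟩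
  have hconj : (a * x) * u₂ * (a * x)⁻¹ ∈ siegelPrincipalGamma g N :=
    (normal_siegelPrincipalGamma (n := g) (q := N)).conj_mem _ hu₂ _
  have h := (siegelPrincipalGamma g N).mul_mem hγ ((siegelPrincipalGamma g N).inv_mem hconj)
  rw [hid, mul_assoc _ ((a * x) * u₂ * (a * x)⁻¹), mul_inv_cancel, mul_one] at h
  -- `h` now has `hid` substituted inside `γ`; recover the factor
  simpa using h

end Cocycle

end SiegelModuli

end Literature.AlgebraicGeometry.ModuliOfAbelianVarieties
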